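import Summits.CriticalPhenomena.CardyFormulaZ2.Theorems.CardyComplexConeEdgePrecompactUFRSArmDominationSplit
import Summits.CriticalPhenomena.CardyFormulaZ2.Theorems.CardyComplexConeEdgePrecompactUFRSArmDominationInitial

/-!
# The corrected arm domination of UFRS, assembled from its residual planar sub-goals
(line `qkz-strip-boundary-arm` of crux `CardyComplexCone.EdgePrecompact`, stmt-CriticalPhenomena-11387;
item (H₁) `ufrs_armDomination2` of the corrected road map for the uniform forward response
stability "UFRS": module docstrings of `…UFRSAnnulusCrossings.lean` (correction) and
`…UFRSEvents.lean` (vocabulary))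

`ufrs_armDomination2` (registered): every forward-response failure at a `2ρ`-deep ball of radius
`ρ ≥ 4η`, shift `‖E.δ w‖ < η`, fine mesh, lies in the certificate `ufrsCert E w z (4η) (ρ/2)` at
some collar point `z ∈ D`. This file assembles it from the deterministic failure analysis of the
line — `ufrs_failureStructure` (INITIAL / FACE / SPLIT), `ufrs_faceCase_cert`
(`…ArmDominationFace.lean`, complete), `ufrs_splitCase_cert_of` (`…ArmDominationSplit.lean`:
`ufrs_lastDeparture`, the free tail `ufrs_freeTailCase_cert_of`, the run ending on the stretch)
and `ufrs_initialCase_cert_of` (`…ArmDominationInitial.lean`) — CONDITIONALLY on four registered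
residual sub-goals, the configurations in which the named strands of the analysis (pieces of
the first stretch, the free tail of the second run, the return journey of the exploration) do
not provide the second or third long strand of the certificate at the collar point, and a
planar argument is required:
* `ufrs_slippedReturnCase_cert` — SPLIT, the run of the second dynamics ends AT the re-entry
  corner of the first stretch with a turning mismatch (case (B) of the road map): needs the
  enclosure statement "a mismatch forces the cusp-free bigon to surround the ball" (Hopf's
  Umlaufsatz + hole-freeness of the inner faces); the registered disc-rigidity lemma
  `ufrs_bigonTurning` does not serve here (with common prefix `{{e}}` its disc hypotheses are
  contradictory);
* `ufrs_doublyMarkedCase_cert` — SPLIT, start pair, free tail to the exit corner of the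
  translate, both marked corners within `ρ/4` of the last contact: needs "the far-reaching
  cluster explored by `E` is bounded by an interface of the translate's dynamics passing next to
  the last contact" (planar duality for the medial dynamics of two configurations);
* `ufrs_initialContactCase_cert` — INITIAL with a contact of nonzero turning offset (a split
  analysis from the contact corner carrying an initial offset);
* `ufrs_initialExitNearCase_cert` — INITIAL, disjoint start strands, the exploration of the
  translate ends within `ρ/4` of the start (the doubly marked configuration again).

References: S. Smirnov, C. R. Acad. Sci. Paris 333 (2001), §2; G. F. Lawler, O. Schramm,
W. Werner, Electron. J. Probab. 7 (2002), App. A; P. Nolin, Electron. J. Probab. 13 (2008), §4;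
H. Hopf, Compositio Math. 2 (1935).
-/

namespace Summit.CriticalPhenomena.CardyFormulaZ2.Cruxes.EdgePrecompact.QkzStripBoundaryArm

open MeasureTheory Filter Set Metric
open scoped Topology BigOperators Pointwise
open Literature.Probability.LatticeModels Literature.Probability.Percolation
open Literature.Probability.RandomPlanarGeometry (DobrushinDomain)
open Summit.CriticalPhenomena.CardyFormulaZ2.Theses.CardyComplexCone

noncomputable section

/-- **The corrected arm domination (H₁) from the four residual planar sub-goals**
(registered conditional sub-goal `ufrs_armDomination2_of_residuals` of
stmt-CriticalPhenomena-11387). HYPOTHESES (the named propositions of `…ArmDominationResiduals.lean`,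
verbatim the registered residual sub-goals, each a certificate
`∃ z ∈ D, infDist z Dᶜ < 3η ∧ ω ∈ ufrsCert E w z (4η) (ρ/2)` for one explicit configuration of
the failure analysis): `ufrs_slippedReturnCase_cert` (SPLIT, the second run ends at the re-entry
corner with a turning mismatch — case (B)), `ufrs_doublyMarkedCase_cert` (SPLIT, start pair,
free tail to the exit corner of the translate, both marked corners within `ρ/4` of the last
contact), `ufrs_initialContactCase_cert` (INITIAL with a contact of nonzero offset),
`ufrs_initialExitNearCase_cert` (INITIAL, disjoint start strands, exit of the translate within
`ρ/4` of the start). CONCLUSION: the registered statement of `ufrs_armDomination2` verbatim —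
every forward-response failure is certified at a collar point. Proof: `ufrs_failureStructure`,
then `ufrs_initialCase_cert_of`, `ufrs_faceCase_cert`, `ufrs_splitCase_cert_of`. -/
theorem ufrs_armDomination2_of_residuals : ufrsResidualSlippedReturn → ufrsResidualDoublyMarked → ufrsResidualInitialContact → ufrsResidualInitialExitNear → ∀ (D : DobrushinDomain) (η : ℝ), 0 < η → ∃ δ₀ > (0:ℝ), ∀ E : DiscreteDobrushin, E.Ω = D.carrier → E.IsZdAdmissible → E.δ < δ₀ → ∀ (v w : Site 2) (ρ : ℝ), 4 * η ≤ ρ → 2 * ρ ≤ infDist (meshPoint E.δ v) D.carrierᶜ → ‖meshPoint E.δ w‖ < η → ∀ ω : BondConfig (Site 2), (¬ ∀ a a' : Site 2 × Fin 4, ((E.IsStartCorner a ∧ (shiftData E w).IsStartCorner a') ∨ (a = a' ∧ medialPoint E.δ (cSrc a) ∈ ball (meshPoint E.δ v) ρ ∧ medialPoint E.δ (cTgt a) ∉ ball (meshPoint E.δ v) ρ)) → ∀ n : ℕ, (∀ i < n, medialPoint E.δ (cTgt (cornerOrbit (E.bcBondConfig ω) a i)) ∉ ball (meshPoint E.δ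 v) ρ ∧ E.IsInnerFace (cFace (cornerOrbit (E.bcBondConfig ω) a (i + 1)))) → medialPoint E.δ (cTgt (cornerOrbit (E.bcBondConfig ω) a n)) ∈ ball (meshPoint E.δ v) ρ → ∃ n' : ℕ, (∀ i < n', medialPoint E.δ (cTgt (cornerOrbit ((shiftData E w).bcBondConfig ω) a' i)) ∉ ball (meshPoint E.δ v) ρ ∧ (shiftData E w).IsInnerFace (cFace (cornerOrbit ((shiftData E w).bcBondConfig ω) a' (i + 1)))) ∧ cornerOrbit ((shiftData E w).bcBondConfig ω) a' n' = cornerOrbit (E.bcBondConfig ω) a n ∧ ∑ i ∈ Finset.range n', turnOf ((shiftData E w).bcBondConfig ω) (cornerOrbit ((shiftData E w).bcBondConfig ω) a' i) = ∑ i ∈ Finset.range n, turnOf (E.bcBondConfig ω) (cornerOrbit (E.bcBondConfig ω) a i)) → (∃ z ∈ D.carrier, infDist z D.carrierᶜ < 3 * η ∧ ω ∈ ufrsCert E w z (4 * η) (ρ / 2)) ∨ ω ∈ (∅ : Set (BondConfig (Site 2))) := by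
  intro hRS hDM hIC hIX D η hη
  obtain ⟨δ₁, hδ₁, hfs⟩ := ufrs_failureStructure D η hη
  obtain ⟨δ₂, hδ₂, hface⟩ := ufrs_faceCase_cert D η hη
  obtain ⟨δ₃, hδ₃, hsplit⟩ := ufrs_splitCase_cert_of hRS hDM D η hη
  obtain ⟨δ₄, hδ₄, hinit⟩ := ufrs_initialCase_cert_of hIC hIX D η hη
  refine ⟨min (min δ₁ δ₂) (min δ₃ δ₄), lt_min (lt_min hδ₁ hδ₂) (lt_min hδ₃ hδ₄), ?_⟩
  intro E hEΩ hE hEδ v w ρ hηρ hv hw ω hfail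
  have hδ₁' : E.δ < δ₁ := lt_of_lt_of_le hEδ ((min_le_left _ _).trans (min_le_left _ _))
  have hδ₂' : E.δ < δ₂ := lt_of_lt_of_le hEδ ((min_le_left _ _).trans (min_le_right _ _))
  have hδ₃' : E.δ < δ₃ := lt_of_lt_of_le hEδ ((min_le_right _ _).trans (min_le_left _ _))
  have hδ₄' : E.δ < δ₄ := lt_of_lt_of_le hEδ ((min_le_right _ _).trans (min_le_right _ _))
  left
  -- the failing pair
  obtain ⟨a, a', hpair, hnot⟩ : ∃ a a' : Site 2 × Fin 4, ((E.IsStartCorner a ∧ (shiftData E w).IsStartCorner a') ∨ (a = a' ∧ medialPoint E.δ (cSrc a) ∈ ball (meshPoint E.δ v) ρ ∧ medialPoint E.δ (cTgt a) ∉ ball (meshPoint E.δ v) ρ)) ∧ ¬ ∀ n : ℕ, (∀ i < n, medialPoint E.δ (cTgt (cornerOrbit (E.bcBondConfig ω) a i)) ∉ ball (meshPoint E.δ v) ρ ∧ E.IsInnerFace (cFace (cornerOrbit (E.bcBondConfig ω) a (i + 1)))) → medialPoint E.δ (cTgt (cornerOrbit (E.bcBondConfig ω) a n)) ∈ ball (meshPoint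 E.δ v) ρ → ∃ n' : ℕ, (∀ i < n', medialPoint E.δ (cTgt (cornerOrbit ((shiftData E w).bcBondConfig ω) a' i)) ∉ ball (meshPoint E.δ v) ρ ∧ (shiftData E w).IsInnerFace (cFace (cornerOrbit ((shiftData E w).bcBondConfig ω) a' (i + 1)))) ∧ cornerOrbit ((shiftData E w).bcBondConfig ω) a' n' = cornerOrbit (E.bcBondConfig ω) a n ∧ ∑ i ∈ Finset.range n', turnOf ((shiftData E w).bcBondConfig ω) (cornerOrbit ((shiftData E w).bcBondConfig ω) a' i) = ∑ i ∈ Finset.range n, turnOf (E.bcBondConfig ω) (cornerOrbit (E.bcBondConfig ω) a i) := by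
    by_contra h
    apply hfail
    intro a a' hpair
    by_contra h'
    exact h ⟨a, a', hpair, h'⟩
  obtain ⟨n, hStr, hball, hcases⟩ := hfs E hEΩ hE hδ₁' v w ρ hηρ hv hw ω a a' (shiftData E w) (E.bcBondConfig ω)
    ((shiftData E w).bcBondConfig ω) {e | medialPoint E.δ e ∈ ball (meshPoint E.δ v) ρ} rfl rfl rfl rfl hpair hnot
  rcases hcases with ⟨ha, ha', hini⟩ | ⟨m, k, hmn, hStr₁, hek, hsum, hcol, hFS⟩
  · exact hinit E hEΩ hE hδ₄' v w ρ hηρ hv hw ω a a' n ha ha' hStr hball hini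
  · rcases hFS with ⟨hiff, hstep, -, hnot₁⟩ | ⟨hniff, hmis, T, hrun, hend⟩
    · exact hface E hEΩ hE hδ₂' v w ρ hηρ hv hw ω a a' n m k hpair hStr hball hmn (fun i hi => (hStr₁ i hi).2) hek
        hiff hstep hnot₁
    · exact hsplit E hEΩ hE hδ₃' v w ρ hηρ hv hw ω a a' n m k T hpair hStr hball hmn hStr₁ hek hsum hcol hniff hmis hrun hend

end

end Summit.CriticalPhenomena.CardyFormulaZ2.Cruxes.EdgePrecompact.QkzStripBoundaryArm
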